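import Mathlib.GroupTheory.MonoidLocalization.GrothendieckGroup
import Literature.AlgebraicGeometry.Frobenioids.PadicValueMonoids
import HarnessLib

/-!
# Frobenioids II, Example 1.1 (i): `ord(K^×) = ord(O_K^⊳)^gp` and the divisor map `K^× → ord(O_K^⊳)^gp`

Mochizuki, *The geometry of Frobenioids II*, Kyushu J. Math. **62** (2008) 401–460, §1 Example 1.1 (i),
author's text pp. 7–8 [cite: MochizukiFrdII2008, Ex 1.1 (i) pp.7-8]: the monoid `B₀ : Spec K ↦ K^×`
comes "together with a natural homomorphism of monoids `B₀ → Φ₀^gp` [i.e., by considering the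
natural surjection `K^× ↠ ord(K^×)`]", where `ord(K^×) ⊆ ord(K^×) ⊗_ℤ ℝ = (ord(O_K^⊳)^rlf)^gp` — which
uses the identification `ord(K^×) = ord(O_K^⊳)^gp` of the group `K^×/O_K^×` with the groupification
of the monoid `O_K^⊳/O_K^×`.

**Contents (all proved).** For a field `K` with a `ValuativeRel` (notation of
`PadicValueMonoids.lean`): `ordIntToValueGroup : ord(O_K^⊳) → (value group)` is injective;
`gpToValueGroup : ord(O_K^⊳)^gp → (value group)` (the universal extension) is bijective, whence
`gpEquivValueGroup : ord(O_K^⊳)^gp ≃* (value group) ≃* ord(K^×)`; the divisor map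
`divUnits : K^× → ord(O_K^⊳)^gp` (a homomorphism killing `O_K^×`) with
`divUnits x = [x]` for `x ∈ O_K^⊳` (`divUnits_intNonzeroToUnits`); and the hom-versions
`ordIntMapOfHom` of the restriction maps along a valuative ring homomorphism `σ : L → K`, with the
naturality of `divUnits`. This is the arithmetic input of the functor-level construction of the
`p`-adic Frobenioid (`PadicFrobenioidZero.lean`).
-/

namespace Literature.AlgebraicGeometry.Frobenioids

open scoped ValuativeRel
open ValuativeRel Function

universe u

namespace PadicFrd

variable (K : Type u) [Field K] [ValuativeRel K]

/-! ### `ord(O_K^⊳)^gp ≅ ord(K^×)` -/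

/-- `ord(O_K^⊳) → (value group)ˣ`, `[x] ↦ v(x)`: the composite of `ord(O_K^⊳) ⊆ ord(K^×)` with
`ord(K^×) ≅ value group`. [cite: MochizukiFrdII2008, Ex 1.1 (i) p.7] -/
noncomputable def ordIntToValueGroup : OrdInt K →* (ValueGroupWithZero K)ˣ :=
  (ordUnitsEquivValueGroup K).toMonoidHom.comp (ordIntToOrdUnits K)

/-- `[x] ↦ v(x)` on representatives. [cite: MochizukiFrdII2008, Ex 1.1 (i) p.7] -/
@[simp] theorem coe_ordIntToValueGroup_mk (x : intNonzero K) :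
    ((ordIntToValueGroup K (Associates.mk x) : (ValueGroupWithZero K)ˣ) : ValueGroupWithZero K) =
      valuation K (x : K) := rfl

/-- `ord(O_K^⊳) → value group` is injective. [cite: MochizukiFrdII2008, Ex 1.1 (i) p.7] -/
theorem ordIntToValueGroup_injective : Injective (ordIntToValueGroup K) :=
  (ordUnitsEquivValueGroup K).injective.comp (ordIntToOrdUnits_injective K)

/-- The image of `ord(O_K^⊳)` in the value group is `{γ | γ ≤ 1}`.
[cite: MochizukiFrdII2008, Ex 1.1 (i) p.7] -/
theorem ordIntToValueGroup_le_one (a : OrdInt K) :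
    ((ordIntToValueGroup K a : (ValueGroupWithZero K)ˣ) : ValueGroupWithZero K) ≤ 1 := by
  obtain ⟨x, rfl⟩ := Associates.mk_surjective a
  rw [coe_ordIntToValueGroup_mk]
  exact x.2.1

/-- Every `γ ≤ 1` of the value group is `v(x)` for some `x ∈ O_K^⊳`.
[cite: MochizukiFrdII2008, Ex 1.1 (i) p.7] -/
theorem exists_ordIntToValueGroup_eq (γ : (ValueGroupWithZero K)ˣ) (hγ : (γ : ValueGroupWithZero K) ≤ 1) :
    ∃ a : OrdInt K, ordIntToValueGroup K a = γ := by
  obtain ⟨x, hx⟩ := unitsToValueGroup_surjective K γ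
  have hx' : valuation K (x : K) = γ := by rw [← hx]; rfl
  refine ⟨Associates.mk ⟨(x : K), ?_, x.ne_zero⟩, Units.ext ?_⟩
  · rw [hx']; exact hγ
  · rw [coe_ordIntToValueGroup_mk, hx']

/-- `ord(O_K^⊳)^gp → value group`, the extension of `[x] ↦ v(x)` to the groupification
(the identification `ord(O_K^⊳)^gp = ord(K^×)`). [cite: MochizukiFrdII2008, Ex 1.1 (i) pp.7-8] -/
noncomputable def gpToValueGroup : Algebra.GrothendieckGroup (OrdInt K) →* (ValueGroupWithZero K)ˣ :=
  Algebra.GrothendieckGroup.lift (ordIntToValueGroup K)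

/-- `gpToValueGroup` extends `ordIntToValueGroup`. [cite: MochizukiFrdII2008, Ex 1.1 (i) pp.7-8] -/
@[simp] theorem gpToValueGroup_of (a : OrdInt K) :
    gpToValueGroup K (Algebra.GrothendieckGroup.of a) = ordIntToValueGroup K a := by
  have h := Algebra.GrothendieckGroup.lift.symm_apply_apply (ordIntToValueGroup K)
  rw [Algebra.GrothendieckGroup.lift_symm_apply] at h
  exact DFunLike.congr_fun h a

/-- `ord(O_K^⊳)^gp → value group` is injective (the monoid `ord(O_K^⊳)` embeds in the group
`ord(K^×)`). [cite: MochizukiFrdII2008, Ex 1.1 (i) pp.7-8] -/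
theorem gpToValueGroup_injective : Injective (gpToValueGroup K) := by
  rw [injective_iff_map_eq_one]
  intro z hz
  rw [gpToValueGroup, Algebra.GrothendieckGroup.lift_apply, div_eq_one] at hz
  have h := ordIntToValueGroup_injective K hz
  -- `z * of s = of m` with `m = s`
  have hs := Submonoid.LocalizationMap.sec_spec (f := Localization.monoidOf ⊤) z
  rw [h] at hs
  exact mul_eq_right.mp hs

/-- `ord(O_K^⊳)^gp → value group` is surjective (every element of `ord(K^×)` is a difference of
elements of `ord(O_K^⊳)`). [cite: MochizukiFrdII2008, Ex 1.1 (i) pp.7-8] -/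
theorem gpToValueGroup_surjective : Surjective (gpToValueGroup K) := by
  intro γ
  by_cases hγ : (γ : ValueGroupWithZero K) ≤ 1
  · obtain ⟨a, ha⟩ := exists_ordIntToValueGroup_eq K γ hγ
    exact ⟨Algebra.GrothendieckGroup.of a, by rw [gpToValueGroup_of, ha]⟩
  · have hγ' : ((γ⁻¹ : (ValueGroupWithZero K)ˣ) : ValueGroupWithZero K) ≤ 1 := by
      rw [Units.val_inv_eq_inv_val]
      exact inv_le_one_of_one_le₀ (le_of_not_ge hγ)
    obtain ⟨a, ha⟩ := exists_ordIntToValueGroup_eq K γ⁻¹ hγ'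
    exact ⟨(Algebra.GrothendieckGroup.of a)⁻¹, by rw [map_inv, gpToValueGroup_of, ha, inv_inv]⟩

/-- `ord(O_K^⊳)^gp ≅ value group (≅ ord(K^×))`: "`ord(K^×)`" IS the groupification of `ord(O_K^⊳)`
(FrdII Ex. 1.1 (i), pp. 7–8, where `ord(K^×) ⊆ ord(K^×) ⊗ ℝ = (ord(O_K^⊳)^rlf)^gp` is used).
[cite: MochizukiFrdII2008, Ex 1.1 (i) pp.7-8] -/
noncomputable def gpEquivValueGroup : Algebra.GrothendieckGroup (OrdInt K) ≃* (ValueGroupWithZero K)ˣ :=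
  MulEquiv.ofBijective (gpToValueGroup K) ⟨gpToValueGroup_injective K, gpToValueGroup_surjective K⟩

/-- `ord(O_K^⊳)^gp ≅ ord(K^×)`. [cite: MochizukiFrdII2008, Ex 1.1 (i) pp.7-8] -/
noncomputable def gpEquivOrdUnits : Algebra.GrothendieckGroup (OrdInt K) ≃* OrdUnits K :=
  (gpEquivValueGroup K).trans (ordUnitsEquivValueGroup K).symm

/-! ### The divisor map `K^× → ord(O_K^⊳)^gp` -/

/-- "`B₀ → Φ₀^gp` [by considering the natural surjection `K^× ↠ ord(K^×)`]" (FrdII Ex. 1.1 (i), p. 7),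
before realification: `K^× ↠ ord(K^×) ≅ ord(O_K^⊳)^gp`. [cite: MochizukiFrdII2008, Ex 1.1 (i) p.7] -/
noncomputable def divUnits : Kˣ →* Algebra.GrothendieckGroup (OrdInt K) :=
  (gpEquivValueGroup K).symm.toMonoidHom.comp (unitsToValueGroup K)

/-- `divUnits` after `gpToValueGroup` is the valuation. [cite: MochizukiFrdII2008, Ex 1.1 (i) p.7] -/
@[simp] theorem gpToValueGroup_divUnits (x : Kˣ) : gpToValueGroup K (divUnits K x) = unitsToValueGroup K x :=
  (gpEquivValueGroup K).apply_symm_apply _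

/-- On integers the divisor map is the class map: `divUnits x = [x] ∈ ord(O_K^⊳) ⊆ ord(O_K^⊳)^gp` for
`x ∈ O_K^⊳`. [cite: MochizukiFrdII2008, Ex 1.1 (i) p.7] -/
theorem divUnits_intNonzeroToUnits (x : intNonzero K) :
    divUnits K (intNonzeroToUnits K x) = Algebra.GrothendieckGroup.of (Associates.mk x) := by
  apply gpToValueGroup_injective K
  rw [gpToValueGroup_divUnits, gpToValueGroup_of]
  exact Units.ext rfl

/-- `divUnits` kills exactly `O_K^×`. [cite: MochizukiFrdII2008, Ex 1.1 (i) p.7] -/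
theorem ker_divUnits : (divUnits K).ker = unitSubgroup K := by
  ext x
  rw [MonoidHom.mem_ker, ← ker_unitsToValueGroup, MonoidHom.mem_ker, ← gpToValueGroup_divUnits]
  constructor
  · intro h; rw [h, map_one]
  · intro h; exact gpToValueGroup_injective K (by rw [h, map_one])

/-! ### Hom-versions of the restriction maps and naturality of `divUnits` -/

section Hom

variable {K} {L : Type u} [Field L] [ValuativeRel L]

/-- A *valuative* ring homomorphism `σ : L → K`: one along which the valuative relations correspond
(the morphisms `Spec K → Spec L` of valued fields along which `O_L = σ⁻¹(O_K)`).
[cite: MochizukiFrdII2008, Ex 1.1 (i) p.7] -/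
def IsValHom (σ : L →+* K) : Prop := ∀ a b : L, σ a ≤ᵥ σ b ↔ a ≤ᵥ b

/-- A valuative ring homomorphism `σ : L → K` makes `K` a valuative extension of `L`.
[cite: MochizukiFrdII2008, Ex 1.1 (i) p.7] -/
theorem valuativeExtension_of_hom (σ : L →+* K) (hσ : IsValHom σ) :
    letI := σ.toAlgebra; ValuativeExtension L K :=
  letI := σ.toAlgebra; ⟨hσ⟩

/-- `O_L^⊳ → O_K^⊳` along a valuative ring homomorphism `σ : L → K` (restriction map of `Spec K ↦ O_K^⊳`
along `Spec K → Spec L`). [cite: MochizukiFrdII2008, Ex 1.1 (i) p.7] -/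
def intNonzeroMapOfHom (σ : L →+* K) (hσ : IsValHom σ) : intNonzero L →* intNonzero K :=
  letI := σ.toAlgebra
  haveI := valuativeExtension_of_hom σ hσ
  intNonzeroMap K L

/-- The value of `intNonzeroMapOfHom`. [cite: MochizukiFrdII2008, Ex 1.1 (i) p.7] -/
@[simp] theorem coe_intNonzeroMapOfHom (σ : L →+* K) (hσ : IsValHom σ) (x : intNonzero L) :
    (intNonzeroMapOfHom σ hσ x : K) = σ x := rfl

/-- `ord(O_L^⊳) → ord(O_K^⊳)` along `σ` (restriction map of `Φ₀` before realification).
[cite: MochizukiFrdII2008, Ex 1.1 (i) p.7] -/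
def ordIntMapOfHom (σ : L →+* K) (hσ : IsValHom σ) : OrdInt L →* OrdInt K :=
  associatesMap (intNonzeroMapOfHom σ hσ)

/-- `ordIntMapOfHom` on representatives. [cite: MochizukiFrdII2008, Ex 1.1 (i) p.7] -/
@[simp] theorem ordIntMapOfHom_mk (σ : L →+* K) (hσ : IsValHom σ) (x : intNonzero L) :
    ordIntMapOfHom σ hσ (Associates.mk x) = Associates.mk (intNonzeroMapOfHom σ hσ x) :=
  associatesMap_mk _ _

/-- `ord(O_L^⊳)^gp → ord(O_K^⊳)^gp` along `σ` (restriction map of `Φ₀^gp`).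
[cite: MochizukiFrdII2008, Ex 1.1 (i) p.7] -/
noncomputable def gpMapOfHom (σ : L →+* K) (hσ : IsValHom σ) :
    Algebra.GrothendieckGroup (OrdInt L) →* Algebra.GrothendieckGroup (OrdInt K) :=
  Algebra.GrothendieckGroup.lift (Algebra.GrothendieckGroup.of.comp (ordIntMapOfHom σ hσ))

/-- `gpMapOfHom` extends `ordIntMapOfHom`. [cite: MochizukiFrdII2008, Ex 1.1 (i) p.7] -/
@[simp] theorem gpMapOfHom_of (σ : L →+* K) (hσ : IsValHom σ) (a : OrdInt L) :
    gpMapOfHom σ hσ (Algebra.GrothendieckGroup.of a) = Algebra.GrothendieckGroup.of (ordIntMapOfHom σ hσ a) := by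
  have h := Algebra.GrothendieckGroup.lift.symm_apply_apply
    (Algebra.GrothendieckGroup.of.comp (ordIntMapOfHom σ hσ))
  rw [Algebra.GrothendieckGroup.lift_symm_apply] at h
  exact DFunLike.congr_fun h a

/-- Naturality of the divisor map: for `x ∈ L^×`, `div_K(σ x) = (σ-restriction)(div_L(x))` — the
homomorphism `B₀ → Φ₀^gp` is a morphism of monoids on `D₀` (FrdII Ex. 1.1 (i), p. 7).
[cite: MochizukiFrdII2008, Ex 1.1 (i) p.7] -/
theorem divUnits_map (σ : L →+* K) (hσ : IsValHom σ) (x : Lˣ) :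
    divUnits K (Units.map (σ : L →* K) x) = gpMapOfHom σ hσ (divUnits L x) := by
  -- both sides are homomorphisms in `x`; `L^×` is generated by `O_L^⊳` and inverses, where they agree
  suffices key : ∀ y : intNonzero L,
      divUnits K (Units.map (σ : L →* K) (intNonzeroToUnits L y)) =
        gpMapOfHom σ hσ (divUnits L (intNonzeroToUnits L y)) by
    by_cases hx : valuation L (x : L) ≤ 1
    · have e : intNonzeroToUnits L ⟨(x : L), hx, x.ne_zero⟩ = x := Units.ext rfl
      have h := key ⟨x, hx, x.ne_zero⟩
      rwa [e] at h
    · have hx' : valuation L ((x⁻¹ : Lˣ) : L) ≤ 1 := by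
        rw [Units.val_inv_eq_inv_val, map_inv₀]
        exact inv_le_one_of_one_le₀ (le_of_not_ge hx)
      have h := key ⟨((x⁻¹ : Lˣ) : L), hx', (x⁻¹).ne_zero⟩
      have e : intNonzeroToUnits L ⟨((x⁻¹ : Lˣ) : L), hx', (x⁻¹).ne_zero⟩ = x⁻¹ := Units.ext rfl
      rw [e, map_inv, map_inv, map_inv, map_inv, inv_inj] at h
      exact h
  intro y
  have e : Units.map (σ : L →* K) (intNonzeroToUnits L y) = intNonzeroToUnits K (intNonzeroMapOfHom σ hσ y) :=
    Units.ext rfl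
  rw [e, divUnits_intNonzeroToUnits, divUnits_intNonzeroToUnits, gpMapOfHom_of, ordIntMapOfHom_mk]

end Hom

end PadicFrd

end Literature.AlgebraicGeometry.Frobenioids
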